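/-
Copyright (c) 2026 the pub-hodgecm-mathlib formalisation cell (harness21).  Prover seat hodgecm-mathlib-K2E3-p21 (g8), Track B «K2-LIT» ∕ h413,
line `K2_E3_EllipticInputs`, unit U12 «Characters», PART «RANK», leaf (qs2-ps) `sig_K2E3CharLocIntNearPrincipalSeriesQuasiSplitTwo`, road «van Dijk₂».
SUB-BRICK (VDW-CORE₂) of (ASM₂), FILE A2: the junction `dg₂ = Re Δ₂` on `T₂` between Harish-Chandra's Weyl denominator `dg₂ = D_G` (★ `dgFormula₂`, the (HCD₂) currency)
and van Dijk's weight `Δ₂` (the (VDW₂) currency); `dg₂` is a class function.  2026-09-04.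
-/
import Summits.HodgeConjecture.HodgeConjecture.Theorems.K2E3QuasiSplitTwoVanDijkCore                   -- ★ (this seat) FILE A1: `vanDijkWeight₂_re_eq_sqrt_prod_normAbs_sub`, `normAbs`-products of units, `prod_normAbs_apply_ne_zero`; brings ★ D115 `dgFormula₂`
import HarnessLib

/-!
# K2_E3 road (h413 = stmt-HodgeConjecture-24833), PART «RANK», leaf (qs2-ps) «van Dijk₂» — SUB-BRICK (VDW-CORE₂), FILE A2:
# THE JUNCTION `D_G = Re Δ₂` ON THE DIAGONAL TORUS OF `U(Φ₂)(L⁺_v)`; `D_G` IS A CLASS FUNCTION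
# [Rogawski1990, §4.9 p. 54, (4.9.4) p. 56; §12.5 p. 182; §12.7 L. 12.7.2 (proof) p. 193] [HarishChandra1970, Part VII §1]

Cell `pub/hodgecm-mathlib` (D-0151), Track B (21-frontier RULING «PUSH BOTH» 2026-09-03), `--supports stmt-HodgeConjecture-24833 --as helper` (count-neutral);
THEOREMS ONLY — no `def`, no instance, no notation, no named fact, no `sorry`; ★-only imports.  Seat K2E3-p21 (g8), (ASM₂)+head of (qs2-ps) BY BOOK (dealer
K2E3-plan (g4) 2026-09-04T13:33:49Z).  The N = 2 twin of ★ `K2E3PrincipalSeriesCharPrelims` §1 (`dgFormula_coe_torus_eq_vanDijkWeight_re`, `dgFormula_conj`): the two facts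
about ★ D115 `dgFormula₂` (`dg₂(g) = ⁴√(∏_w |disc χ_g|_w · (∏_w |det g|_w)⁻¹)`, K2E3-p26 (g0)) that the assembly (ASM₂) `Theorems/K2E3CharLocIntNearPrincipalSeriesQuasiSplitTwo.lean`
needs in order to combine the (HCD₂) letter «`dg₂⁻¹ ∈ L¹_loc`» (★ p860826 K2E3-p27, `dgFormula₂` currency) and the (WEYL₂) density `dg₂²` (★ p860877 K2E3-p14) with the
(VDW₂) letter (★ p860845 K2E3-p11, `vanDijkWeight₂` currency); continuity of `dg₂` is ★ `K2E3QuasiSplitTwoWeylDensity.continuous_dgFormula₂` (not repeated here):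
* `dgFormula₂_coe_torus_eq_vanDijkWeight₂_re` — **`dg₂(t) = Re Δ₂(t)` for EVERY `t ∈ T₂`** (every finite `v`): `disc χ_t = (d₀ − d₁)²`, `det t = d₀ d₁`,
  `∏_w |d₀,w|_w |d₁,w|_w = ‖d₀‖ ‖d₁‖ = 1` (torus relation `σ(d₀) d₁ = 1`, ★ `LineRing.distribHaarChar_torus_two`), so both sides are `√(∏_w |(d₀ − d₁)_w|_w)` (FILE A1);
* `dgFormula₂_conj` — `dg₂` is a class function (`charpoly`, `det` are conjugation invariant).
Print: `D_G(γ) = |Π_{α ∈ Φ}(1 − α(γ))|^{1∕2}` (Rogawski p. 54), `Δ(m) = |D_G(m)|` (p. 193).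
ELABORATION NOTE (for the next hand): never rewrite INSIDE the `dg₂` tokens of a goal that also carries the other token — a near-miss comparison `∏_w|disc_w| =?= ∏_w|det_w|`
sends the unifier into `Matrix.det` ∕ `Polynomial.discr`; compute the two scalars separately and assemble by `Eq.trans` (see the proof of the junction).

HONEST LABEL: HC_CM is proved only modulo the 7 printed citations (2 remaining named inputs: hLiu418 = stmt-HodgeConjecture-24832, h413 = stmt-HodgeConjecture-24833)
until rung 0 closes; count-neutral helper toward the OPEN leaf (qs2-ps); it closes nothing by itself.

## References
* [Rogawski1990] J. D. Rogawski, *Automorphic Representations of Unitary Groups in Three Variables*, Ann. of Math. Stud. 123 (1990): §4.9 p. 54 (`D_G`), (4.9.4) p. 56;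
  §12.5 p. 182; §12.7 L. 12.7.2 (proof) p. 193.
* [HarishChandra1970] Harish-Chandra (notes by G. van Dijk), *Harmonic Analysis on Reductive p-adic Groups*, LNM 162 (1970), Part VII §1 (`D_G`, Thm. 15).
* [WeilBNT1967] A. Weil, *Basic Number Theory* (1967), Ch. I §2 (the module of a local field).
-/

set_option autoImplicit false
-- the mandated namespace has the single-problem summit's repeated segment (`HodgeConjecture.HodgeConjecture`)
set_option linter.dupNamespace false

noncomputable section

open NumberField IsDedekindDomain MeasureTheory Topology Filter
open scoped Matrix MatrixGroups NNReal
open Literature.NumberTheory.Rogawski1990 Literature.NumberTheory.Automorphic Literature.NumberTheory.Automorphic.UnitaryGroup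
open Literature.NumberTheory.GaloisRepresentations Literature.NumberTheory.GaloisRepresentations.IsNonarchimedeanLocalField
open Literature.MeasureTheory.Group
open Summit.HodgeConjecture.HodgeConjecture.Cruxes.H413.K2E3QuasiSplitTwoTorusDefs
open Summit.HodgeConjecture.HodgeConjecture.Cruxes.H413.K2E3QuasiSplitTwoVanDijkCore

namespace Summit.HodgeConjecture.HodgeConjecture.Cruxes.H413.K2E3QuasiSplitTwoWeylDiscrJunction

variable (L : Type) [Field L] [NumberField L] [IsCMField L] (v : HeightOneSpectrum (𝓞 ↥(maximalRealSubfield L)))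

/-! ## The junction `dg₂ = Re Δ₂` on `T₂`; `dg₂` is a class function, continuous on `G₂` -/

omit [IsCMField L] in
/-- `disc χ_{diag(d₀,d₁)} = (d₀ − d₁)²` (written as a product) and `det diag(d₀,d₁) = d₀ d₁` (Mathlib `Matrix.discr_fin_two`, `Matrix.det_diagonal`). [cite: Rogawski1990, §4.9 p. 54] -/
theorem discr_charpoly_and_det_glDiagonal_two (d : Fin 2 → (LocalRing L v)ˣ) :
    (glDiagonal 2 (LocalRing L v) d : GL (Fin 2) (LocalRing L v)).val.charpoly.discr =
        ((d 0 : LocalRing L v) - d 1) * ((d 0 : LocalRing L v) - d 1) ∧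
      (glDiagonal 2 (LocalRing L v) d : GL (Fin 2) (LocalRing L v)).val.det = (d 0 : LocalRing L v) * d 1 := by
  rw [coe_glDiagonal]
  refine ⟨?_, ?_⟩
  · rw [← Matrix.discr, Matrix.discr_fin_two, Matrix.trace_diagonal, Matrix.det_diagonal, Fin.sum_univ_two, Fin.prod_univ_two]
    ring
  · rw [Matrix.det_diagonal, Fin.prod_univ_two]

omit [IsCMField L] in
/-- `|(x y)_w|_w = |x_w|_w |y_w|_w` (evaluation at a place is a ring map; `|·|_w` is multiplicative). [cite: WeilBNT1967, Ch. I §2] -/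
theorem normAbs_mul_apply (w : PlacesOver L v) (x y : LocalRing L v) :
    normAbs (w.1.adicCompletion L) ((x * y) w) = normAbs (w.1.adicCompletion L) (x w) * normAbs (w.1.adicCompletion L) (y w) := by
  rw [Pi.mul_apply, map_mul]

/-- **On `T₂`: `∏_w |d₀,w|_w · ∏_w |d₁,w|_w = 1`** — the torus relation `σ(d₀) d₁ = 1` in module currency (`‖d₁‖ = ‖d₀‖⁻¹`, ★ `LineRing.distribHaarChar_torus_two`;
`‖·‖ = ∏_w |·|_w`, ★ `unitModulusChar_localRing_eq_prod`). [cite: Rogawski1990, §1.10 p. 9; §12.2 p. 173] -/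
theorem prod_normAbs_torusEntry_mul_eq_one (t : ↥(cmBorelTriple L 2 v).M) :
    (∏ w : PlacesOver L v, normAbs (w.1.adicCompletion L) (((torusEntry (conjLocal L (IsCMField.complexConj L) v) (cmLocalForm L 2 v) 0 t : (LocalRing L v)ˣ) : LocalRing L v) w)) *
      (∏ w : PlacesOver L v, normAbs (w.1.adicCompletion L) (((torusEntry (conjLocal L (IsCMField.complexConj L) v) (cmLocalForm L 2 v) 1 t : (LocalRing L v)ˣ) : LocalRing L v) w)) = 1 := by
  haveI : SecondCountableTopology (LocalRing L v) := secondCountableTopology_localRing (E := L) v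
  letI : MeasurableSpace (LocalRing L v) := borel _
  haveI : BorelSpace (LocalRing L v) := ⟨rfl⟩
  have hd := glDiagonal_torusEntry_two L v t
  have hmod : unitModulusChar (LocalRing L v) (torusEntry (conjLocal L (IsCMField.complexConj L) v) (cmLocalForm L 2 v) 1 t) =
      (unitModulusChar (LocalRing L v) (torusEntry (conjLocal L (IsCMField.complexConj L) v) (cmLocalForm L 2 v) 0 t))⁻¹ := by
    -- elaborate the ★ lemma WITHOUT expected type (its implicit `d` is read off `hd`), then hand it over (`unitModulusChar = distribHaarChar` by `rfl`)
    have h := UnitaryGroup.LineRing.distribHaarChar_torus_two (conjLocal L (IsCMField.complexConj L) v) (conjLocal_conjLocal_cm L v)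
      (continuous_conjLocal L (IsCMField.complexConj L) v) (cmLocalForm_eq_over L 2 v) t hd
    exact h
  have hne : unitModulusChar (LocalRing L v) (torusEntry (conjLocal L (IsCMField.complexConj L) v) (cmLocalForm L 2 v) 0 t) ≠ 0 := by
    rw [unitModulusChar_localRing_eq_prod L v (torusEntry (conjLocal L (IsCMField.complexConj L) v) (cmLocalForm L 2 v) 0 t)]
    exact prod_normAbs_apply_ne_zero L v _
  rw [← unitModulusChar_localRing_eq_prod L v (torusEntry (conjLocal L (IsCMField.complexConj L) v) (cmLocalForm L 2 v) 0 t),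
    ← unitModulusChar_localRing_eq_prod L v (torusEntry (conjLocal L (IsCMField.complexConj L) v) (cmLocalForm L 2 v) 1 t), hmod, mul_inv_cancel₀ hne]

omit [Field L] [NumberField L] [IsCMField L] in
/-- Scalar bookkeeping: `√(√(A · B⁻¹)) = √D` when `A = D · D` and `B = 1`. [folklore] -/
theorem sqrt_sqrt_mul_inv_eq {A B D : ℝ≥0} (hA : A = D * D) (hB : B = 1) : NNReal.sqrt (NNReal.sqrt (A * B⁻¹)) = NNReal.sqrt D := by
  subst hA hB
  rw [inv_one, mul_one, NNReal.sqrt_mul_self]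

/-- **THE TORUS JUNCTION `dg₂(t) = Re Δ₂(t)` FOR EVERY `t ∈ T₂`** (every finite `v`): both sides are `√(∏_w |(d₀ − d₁)_w|_w)` — for `dg₂` through
`disc χ_t = (d₀ − d₁)²`, `det t = d₀d₁` and `∏_w |d₀,w|_w |d₁,w|_w = 1` (`prod_normAbs_torusEntry_mul_eq_one`); for `Δ₂` by §1.  The N = 2 twin of ★
`K2E3PrincipalSeriesCharPrelims.dgFormula_coe_torus_eq_vanDijkWeight_re`. [cite: Rogawski1990, §12.7 L. 12.7.2 (proof) p. 193; §4.9 p. 54, (4.9.4) p. 56; §12.5 p. 182] -/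
theorem dgFormula₂_coe_torus_eq_vanDijkWeight₂_re (t : ↥(cmBorelTriple L 2 v).M) :
    dgFormula₂ L v (t : ↥(unitaryGroupOfForm (conjLocal L (IsCMField.complexConj L) v) (cmLocalForm L 2 v))) = (vanDijkWeight₂ L v t).re := by
  have hd := glDiagonal_torusEntry_two L v t
  obtain ⟨hdisc, hdet⟩ := discr_charpoly_and_det_glDiagonal_two L v (fun i => torusEntry (conjLocal L (IsCMField.complexConj L) v) (cmLocalForm L 2 v) i t)
  -- the two tokens of `dg₂` at `t`: `∏_w |disc_w| = D · D`, `∏_w |det_w| = 1`, `D = ∏_w |(d₀ − d₁)_w|`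
  have hval : ((t : ↥(unitaryGroupOfForm (conjLocal L (IsCMField.complexConj L) v) (cmLocalForm L 2 v))).val : GL (Fin 2) (UnitaryGroup.LocalRing L v)).val =
      (glDiagonal 2 (LocalRing L v) (fun i => torusEntry (conjLocal L (IsCMField.complexConj L) v) (cmLocalForm L 2 v) i t) : GL (Fin 2) (LocalRing L v)).val := by
    rw [hd]
  have hD2 : (∏ w : PlacesOver L v, normAbs (w.1.adicCompletion L)
      ((((t : ↥(unitaryGroupOfForm (conjLocal L (IsCMField.complexConj L) v) (cmLocalForm L 2 v))).val : GL (Fin 2) (UnitaryGroup.LocalRing L v)).val.charpoly.discr) w)) =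
      (∏ w : PlacesOver L v, normAbs (w.1.adicCompletion L) ((((torusEntry (conjLocal L (IsCMField.complexConj L) v) (cmLocalForm L 2 v) 0 t : (LocalRing L v)ˣ) : LocalRing L v) -
        (torusEntry (conjLocal L (IsCMField.complexConj L) v) (cmLocalForm L 2 v) 1 t : (LocalRing L v)ˣ)) w)) *
      (∏ w : PlacesOver L v, normAbs (w.1.adicCompletion L) ((((torusEntry (conjLocal L (IsCMField.complexConj L) v) (cmLocalForm L 2 v) 0 t : (LocalRing L v)ˣ) : LocalRing L v) -
        (torusEntry (conjLocal L (IsCMField.complexConj L) v) (cmLocalForm L 2 v) 1 t : (LocalRing L v)ˣ)) w)) := by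
    rw [hval, hdisc, ← Finset.prod_mul_distrib]
    exact Finset.prod_congr rfl fun w _ => normAbs_mul_apply L v w _ _
  have hP : (∏ w : PlacesOver L v, normAbs (w.1.adicCompletion L)
      ((((t : ↥(unitaryGroupOfForm (conjLocal L (IsCMField.complexConj L) v) (cmLocalForm L 2 v))).val : GL (Fin 2) (UnitaryGroup.LocalRing L v)).val.det) w)) = 1 := by
    rw [hval, hdet]
    exact (Finset.prod_congr rfl fun w _ => normAbs_mul_apply L v w _ _).trans (Finset.prod_mul_distrib.trans (prod_normAbs_torusEntry_mul_eq_one L v t))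
  -- assemble WITHOUT rewriting inside the `dg₂` tokens (a near-miss comparison `∏|disc_w| =?= ∏|det_w|` makes the unifier unfold `det` ∕ `discr`)
  exact (dgFormula₂_def L v _).trans ((congrArg (fun x : ℝ≥0 => (x : ℝ)) (sqrt_sqrt_mul_inv_eq hD2 hP)).trans
    (vanDijkWeight₂_re_eq_sqrt_prod_normAbs_sub L v t).symm)

/-- **`dg₂` IS A CLASS FUNCTION**: `charpoly` and `det` are conjugation invariant (Mathlib `Matrix.charpoly_units_conj`, `Matrix.det_units_conj`).  The N = 2 twin of ★
`K2E3PrincipalSeriesCharPrelims.dgFormula_conj`. [cite: Rogawski1990, §4.9 p. 54; §12.5 p. 182] -/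
theorem dgFormula₂_conj (x h : ↥(unitaryGroupOfForm (conjLocal L (IsCMField.complexConj L) v) (cmLocalForm L 2 v))) :
    dgFormula₂ L v (h * x * h⁻¹) = dgFormula₂ L v x := by
  have hval : ((h * x * h⁻¹).val : GL (Fin 2) (UnitaryGroup.LocalRing L v)).val =
      (h.val : GL (Fin 2) (UnitaryGroup.LocalRing L v)).val * (x.val : GL (Fin 2) (UnitaryGroup.LocalRing L v)).val *
        ((h.val : GL (Fin 2) (UnitaryGroup.LocalRing L v))⁻¹).val := rfl
  have hcp : ((h * x * h⁻¹).val : GL (Fin 2) (UnitaryGroup.LocalRing L v)).val.charpoly = (x.val : GL (Fin 2) (UnitaryGroup.LocalRing L v)).val.charpoly := by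
    rw [hval, Matrix.coe_units_inv, Matrix.charpoly_units_conj]
  have hdet : ((h * x * h⁻¹).val : GL (Fin 2) (UnitaryGroup.LocalRing L v)).val.det = (x.val : GL (Fin 2) (UnitaryGroup.LocalRing L v)).val.det := by
    rw [hval, Matrix.det_units_conj]
  rw [dgFormula₂_def, dgFormula₂_def, hcp, hdet]

end Summit.HodgeConjecture.HodgeConjecture.Cruxes.H413.K2E3QuasiSplitTwoWeylDiscrJunction

end
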